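import Summits.CriticalPhenomena.PercolationContinuityZ3.Theorems.Transplant.KNLevelsLocality
import HarnessLib

/-!
# F6 (generic), part 1 — Kozma–Nitzan Lemma 10, Step III over the LEVELS of any locally finite graph: abstract seed systems, the
# selected contacts, the events `𝒢`, `F_x` and the seed estimate (19) (BLUEPRINT-I-PHI §1/§3 Φ5–Φ7; generalises
# `L/KozmaNitzanTargetLemma.lean` ll. 1272–1660 from `zdGraph d` to a graph `G` with a nested family of finite vertex sets)

builds on p205010 (kernel theorem, internal audit signed; external expert review pending) — nothing in this file uses p205010.
Lane `prim-bschramm`, seat `prim-bschramm-p2` (task F6); helper file (`--supports stmt-CriticalPhenomena-4575`), typed against p3's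
`KNLevelsDefs` / `KNLevelsLocality` (level data `LData G`, hypotheses `LHyp`, contact set `Kont`).

Kozma–Nitzan's Step III (arXiv:2401.12397 §4 p. 19) attaches to every contact vertex `x` of `B⟨j⟩` a SEED (a plaquette in the face of
`B⟨j⟩` through the contact, the edges joining it to the face `U(P)` of the cube behind it, the contact edge), selects `k` far-apart contacts
among `≥ N`, and shows that conditionally on the contact set some selected seed is open with probability `≥ 1 - (1 - p^{|seed|})^k`
((19)).  The ONLY properties of the `ℤ^d` seeds used by this argument and by Steps IV–V are collected in `SHyp`: seed edges are edges of
`G` inside `B⟨j+1⟩`, each meets `B⟨j⟩`, at most `sB` of them, an open seed joins `x` to every vertex of the face behind it, and from `≥ N`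
candidate contacts one can pick `k` with pairwise disjoint seeds.  The data `SData` (candidate contacts `K ⊇ Kont`, `seed`, `face`,
`pick`, `N`, `k`, `sB`) are supplied per instance (`ℤ^d`: `winData`/`seedEdges`/`uface`/`selOf`/`Ncont`/`seedBound`; `X □ ℤ²`:
fibre-ball plaquettes at macro contacts); restricting to a candidate set `K ⊇` every contact set lets an instance ignore outer-boundary
vertices that are never contacts (e.g. off the support).  Contents: §1 `rank` (injective enumeration of a finset, replacing
`Encodable.encode`); §2 `SData`, `SHyp`, `SData.SeedOpen`, `LData.sel/oSeed/Gev/Fx`; §3 under `LHyp`: `W_seed`, `le_real_seedOpen`,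
**(19)** `real_manyContacts_diff_Gev_le`; §4 `Fx_disjoint`, `biUnion_Fx_eq_Gev`, `oSeed_congr`/`Fx_congr`/`determinedBy_Fx` (locality
off a set avoided by the seeds), measurability, `openConn_of_mem_oSeed`.

[cite: KozmaNitzan2024, §4 Lemma 10, p. 19 (Step III, (19)–(20)), p. 21 ("P_{K_ξ}(F_P) = P_G(F_P)") — the ℤ^d model]
[cite: GrimmettPercolation1999, §7.2]
-/

noncomputable section

open MeasureTheory ProbabilityTheory
open scoped ENNReal

namespace Summit.CriticalPhenomena.PercolationContinuityZ3.Theorems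

namespace Transplant

namespace KNLevels

open Literature.Probability.Percolation Literature.Probability.LatticeModels SimpleGraph

variable {V : Type*} [DecidableEq V]

/-! ## §1 An injective enumeration of a finite set -/

open Classical in
/-- The rank of `x` in a fixed enumeration of the finite set `s` (`0` off `s`). [folklore] -/
def rank (s : Finset V) (x : V) : ℕ := if h : x ∈ s then (s.equivFin ⟨x, h⟩ : ℕ) else 0

/-- `rank s` is injective on `s`. [folklore] -/
theorem rank_injOn (s : Finset V) : Set.InjOn (rank s) (↑s : Set V) := by
  intro x hx y hy h
  simp only [rank, dif_pos (Finset.mem_coe.1 hx), dif_pos (Finset.mem_coe.1 hy)] at h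
  exact congrArg Subtype.val (s.equivFin.injective (Fin.ext h))

/-- Distinct elements of `s` have distinct ranks. [folklore] -/
theorem rank_ne_of_ne {s : Finset V} {x y : V} (hx : x ∈ s) (hy : y ∈ s) (hne : x ≠ y) : rank s x ≠ rank s y :=
  fun h => hne (rank_injOn s (Finset.mem_coe.2 hx) (Finset.mem_coe.2 hy) h)

/-! ## §2 Seed systems and the Step-III events -/

/-- **Seed data** at a level (KN p. 19, abstracted): a finite set `K` of candidate contact vertices, for each of them a finite set
`seed x` of seed edges and the face `face x` behind it (the relay candidates of Step IV), a selection rule `pick` extracting contacts with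
disjoint seeds, and the constants `N` (contacts needed), `k` (seeds delivered), `sB` (seed size bound).  The `ℤ^d` original:
`K = ∂^{out} B⟨j⟩`, `seed = seedE`, `face = ufaceX`, `pick = selOf M k`, `N = Ncont d M k`, `sB = seedBound d M`.
[cite: KozmaNitzan2024, §4 p. 19 (seeds, the plaquettes P_1, …, P_k)] -/
structure SData (V : Type*) where
  /-- candidate contact vertices (a finite superset of every contact set at the level) -/
  K : Finset V
  /-- the seed edges of a contact vertex -/
  seed : V → Finset (Sym2 V)
  /-- the face behind a contact vertex -/
  face : V → Finset V
  /-- selection of contacts with pairwise disjoint seeds -/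
  pick : Finset V → Finset V
  /-- number of contacts needed -/
  N : ℕ
  /-- number of disjoint seeds delivered -/
  k : ℕ
  /-- bound on the number of seed edges -/
  sB : ℕ

/-- **The Step-III axioms** of the seed data `σ` relative to the level data `L` at level `j`, over `G`: every contact set at level `j` lies
in `K`; seed edges are edges of `G` with both endpoints in `B⟨j+1⟩`, each with an endpoint in `B⟨j⟩`; at most `sB` of them; an open seed
joins the contact vertex to every vertex of the face behind it; `pick κ ⊆ κ`, and for `κ ⊆ K` with `N ≤ |κ|` it has exactly `k` elements
with pairwise disjoint seeds (KN: `k` plaquettes at mutual distance `> 2M+4` among `N = k·|Λ_{4M+8}|` contacts).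
[cite: KozmaNitzan2024, §4 p. 19 (Step III)] -/
structure SHyp {G : SimpleGraph V} [G.LocallyFinite] (L : LData G) (j : ℕ) (σ : SData V) : Prop where
  Kont_sub : ∀ ω, L.Kont j ω ⊆ σ.K
  edge : ∀ x ∈ σ.K, ∀ e ∈ σ.seed x, e ∈ G.edgeSet
  within : ∀ x ∈ σ.K, ∀ e ∈ σ.seed x, ∀ z ∈ e, z ∈ L.X (j + 1)
  touch : ∀ x ∈ σ.K, ∀ e ∈ σ.seed x, ∃ z ∈ e, z ∈ L.X j
  card_le : ∀ x ∈ σ.K, (σ.seed x).card ≤ σ.sB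
  conn : ∀ x ∈ σ.K, ∀ ω : BondConfig V, (↑(σ.seed x) : Set (Sym2 V)) ⊆ ω → ∀ u ∈ σ.face x, ω ∈ openConn x u
  pick_sub : ∀ κ, σ.pick κ ⊆ κ
  pick_card : ∀ κ ⊆ σ.K, σ.N ≤ κ.card → (σ.pick κ).card = σ.k
  pick_disj : ∀ κ ⊆ σ.K, σ.N ≤ κ.card → (↑(σ.pick κ) : Set V).PairwiseDisjoint σ.seed

namespace SData

variable (σ : SData V)

omit [DecidableEq V] in
/-- All seed edges of `x` are open. [cite: KozmaNitzan2024, §4 p. 19 (seed)] -/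
def SeedOpen (x : V) : Set (BondConfig V) := {ω | (↑(σ.seed x) : Set (Sym2 V)) ⊆ ω}

omit [DecidableEq V] in
/-- `SeedOpen x` only depends on the seed edges of `x`. [folklore] -/
theorem seedOpen_congr {x : V} {ω ω' : BondConfig V} (h : ∀ e ∈ σ.seed x, e ∈ ω ↔ e ∈ ω') :
    ω ∈ σ.SeedOpen x ↔ ω' ∈ σ.SeedOpen x :=
  ⟨fun h' e he => (h e (Finset.mem_coe.1 he)).1 (h' he), fun h' e he => (h e (Finset.mem_coe.1 he)).2 (h' he)⟩

omit [DecidableEq V] in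
/-- `SeedOpen x` is determined by the seed edges of `x`. [folklore] -/
theorem determinedBy_seedOpen (x : V) : DeterminedBy (σ.SeedOpen x) (↑(σ.seed x) : Set (Sym2 V)) := by
  rw [determinedBy_iff]
  intro ω ω' hω
  refine σ.seedOpen_congr fun e he => ?_
  have := Set.ext_iff.1 hω e
  simp only [Set.mem_inter_iff, Finset.mem_coe] at this
  exact ⟨fun h' => (this.1 ⟨h', he⟩).1, fun h' => (this.2 ⟨h', he⟩).1⟩

omit [DecidableEq V] in
/-- `SeedOpen x` is measurable. [folklore] -/
theorem measurableSet_seedOpen (x : V) : MeasurableSet (σ.SeedOpen x) :=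
  (σ.determinedBy_seedOpen x).measurableSet_of_finset

end SData

namespace LData

variable {G : SimpleGraph V} [G.LocallyFinite] (L : LData G) (σ : SData V)

/-- The selected contact vertices at level `j`. [cite: KozmaNitzan2024, §4 p. 19 (P_1, …, P_k)] -/
def sel (j : ℕ) (ω : BondConfig V) : Finset V := σ.pick (L.Kont j ω)

/-- `x` is a selected contact vertex at level `j` whose seed is open ("`P` is a seed in the cluster of `o`").
[cite: KozmaNitzan2024, §4 p. 19 (the events F_P)] -/
def oSeed (j : ℕ) (x : V) : Set (BondConfig V) := {ω | x ∈ L.sel σ j ω} ∩ σ.SeedOpen x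

/-- `𝒢`: some selected contact vertex has an open seed. [cite: KozmaNitzan2024, §4 p. 19 (the event 𝒢, (19))] -/
def Gev (j : ℕ) : Set (BondConfig V) := ⋃ x ∈ σ.K, L.oSeed σ j x

/-- `F_x`: `x` is the FIRST (in the enumeration `rank K`) selected contact vertex with an open seed.
[cite: KozmaNitzan2024, §4 p. 19 ("P is the first such seed in this order")] -/
def Fx (j : ℕ) (x : V) : Set (BondConfig V) :=
  L.oSeed σ j x ∩ ⋂ x' ∈ σ.K.filter (fun x' => rank σ.K x' < rank σ.K x), (L.oSeed σ j x')ᶜ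

variable {L σ}

/-- Selected contacts are contacts. [folklore] -/
theorem sel_subset_Kont (hpick : ∀ κ, σ.pick κ ⊆ κ) {j : ℕ} (ω : BondConfig V) : L.sel σ j ω ⊆ L.Kont j ω := hpick _

/-- Membership in `oSeed`. [folklore] -/
theorem mem_oSeed_iff {j : ℕ} {x : V} {ω : BondConfig V} : ω ∈ L.oSeed σ j x ↔ x ∈ L.sel σ j ω ∧ ω ∈ σ.SeedOpen x := Iff.rfl

/-- Membership in `Gev`. [folklore] -/
theorem mem_Gev_iff {j : ℕ} {ω : BondConfig V} : ω ∈ L.Gev σ j ↔ ∃ x ∈ σ.K, ω ∈ L.oSeed σ j x := by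
  simp only [Gev, Set.mem_iUnion, exists_prop]

/-- Membership in `Fx`. [folklore] -/
theorem mem_Fx_iff {j : ℕ} {x : V} {ω : BondConfig V} :
    ω ∈ L.Fx σ j x ↔ ω ∈ L.oSeed σ j x ∧ ∀ x' ∈ σ.K, rank σ.K x' < rank σ.K x → ω ∉ L.oSeed σ j x' := by
  simp only [Fx, Set.mem_inter_iff, Set.mem_iInter, Finset.mem_filter, Set.mem_compl_iff, and_imp]

end LData

/-! ## §3 The seed estimates under the hypotheses of Lemma 10 -/

namespace LHyp

variable {G : SimpleGraph V} [G.LocallyFinite]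
variable {L : LData G} {W : Sym2 V → unitInterval} {p : unitInterval} {D : Finset V} {R : ℕ}
variable (hL : LHyp L W p D R)
include hL

/-- **Seed edges carry weight `p`**: both endpoints lie in `B⟨j+1⟩ ⊆ D` and they are adjacent in `G`. [cite: KozmaNitzan2024, §4 p. 19] -/
theorem W_seed {σ : SData V} {j : ℕ} (hσ : SHyp L j σ) (hj : j ≤ R) {x : V} (hx : x ∈ σ.K) {e : Sym2 V}
    (he : e ∈ σ.seed x) : W e = p := by
  have hedge := hσ.edge x hx e he
  have hin := hσ.within x hx e he
  induction e using Sym2.ind with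
  | h a b =>
    rw [SimpleGraph.mem_edgeSet] at hedge
    exact hL.sub.adj a (hL.X_subset_D (by omega) (hin a (Sym2.mem_mk_left a b))) b
      (hL.X_subset_D (by omega) (hin b (Sym2.mem_mk_right a b))) hedge

/-- **A seed is open with probability at least `p^{sB}`.** [cite: KozmaNitzan2024, §4 p. 19 ("at least p^{(d+1)(4M)^{d-1}}")] -/
theorem le_real_seedOpen {σ : SData V} {j : ℕ} (hσ : SHyp L j σ) (hj : j ≤ R) {x : V} (hx : x ∈ σ.K) :
    (p : ℝ) ^ σ.sB ≤ (prodBernoulli W).real (σ.SeedOpen x) := by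
  unfold SData.SeedOpen
  rw [prodBernoulli_real_subset W (σ.seed x),
    Finset.prod_congr rfl fun e he => by rw [hL.W_seed hσ hj hx he], Finset.prod_const]
  exact pow_le_pow_of_le_one p.2.1 p.2.2 (hσ.card_le x hx)

open Classical in
/-- **Step III, (19)**: with `≥ N` contact vertices at level `j`, with probability at most `(1 - p^{sB})^k` no selected contact vertex has
an open seed: conditionally on the contact set (determined by the pairs of the region outside `B⟨j⟩`), the `k` selected seeds live on
pairwise disjoint sets of fresh edges (each seed edge meets `B⟨j⟩`). [cite: KozmaNitzan2024, §4 p. 19 ((19))] -/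
theorem real_manyContacts_diff_Gev_le {σ : SData V} {j : ℕ} (hσ : SHyp L j σ) (hj : j ≤ R) :
    (prodBernoulli W).real ((L.Fail σ.N j)ᶜ \ L.Gev σ j) ≤ (1 - (p : ℝ) ^ σ.sB) ^ σ.k := by
  set μ := prodBernoulli W with hμ
  set Bκ : Finset V → Set (BondConfig V) := fun κ => {ω | L.Kont j ω = κ} with hBκ
  set Cx : V → Set (BondConfig V) := fun x => (σ.SeedOpen x)ᶜ with hCx
  set q : ℝ := 1 - (p : ℝ) ^ σ.sB with hq
  have hq0 : 0 ≤ q := by rw [hq, sub_nonneg]; exact pow_le_one₀ p.2.1 p.2.2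
  -- covering
  have hcov : (L.Fail σ.N j)ᶜ \ L.Gev σ j ⊆
      ⋃ κ ∈ σ.K.powerset.filter (fun κ => σ.N ≤ κ.card), (Bκ κ ∩ ⋂ x ∈ σ.pick κ, Cx x) := by
    rintro ω ⟨hE, hG⟩
    simp only [LData.Fail, Set.mem_compl_iff, Set.mem_setOf_eq, not_lt] at hE
    simp only [Set.mem_iUnion, Set.mem_iInter, Set.mem_inter_iff, Finset.mem_filter, Finset.mem_powerset,
      exists_prop, hBκ, hCx, Set.mem_setOf_eq, Set.mem_compl_iff]
    refine ⟨L.Kont j ω, ⟨hσ.Kont_sub ω, hE⟩, rfl, fun x hx hseed => hG ?_⟩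
    rw [LData.mem_Gev_iff]
    exact ⟨x, hσ.Kont_sub ω (hσ.pick_sub _ hx), ⟨hx, hseed⟩⟩
  -- each piece
  have hBdet : ∀ κ, DeterminedBy (Bκ κ) (wireSet (L.region j)) := by
    intro κ; rw [determinedBy_iff]; intro ω ω' hω
    have h1 : ∀ e ∈ wireSet (L.region j), e ∈ ω ↔ e ∈ ω' := fun e he => by
      have := Set.ext_iff.1 hω e; simp only [Set.mem_inter_iff] at this
      exact ⟨fun h' => (this.1 ⟨h', he⟩).1, fun h' => (this.2 ⟨h', he⟩).1⟩
    simp only [hBκ, Set.mem_setOf_eq, LData.Kont_congr h1]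
  have hBm : ∀ κ, MeasurableSet (Bκ κ) := fun κ =>
    ((hBdet κ).mono fun _ he => Finset.mem_coe.2 (L.mem_pairsF_of_mem_wireSet_region he)).measurableSet_of_finset
  have hCdet : ∀ x, DeterminedBy (Cx x) (↑(σ.seed x) : Set (Sym2 V)) := fun x => (σ.determinedBy_seedOpen x).compl
  have hCm : ∀ x, MeasurableSet (Cx x) := fun x => (σ.measurableSet_seedOpen x).compl
  have hCle : ∀ x ∈ σ.K, μ.real (Cx x) ≤ q := by
    intro x hx
    simp only [hCx]
    rw [measureReal_compl (σ.measurableSet_seedOpen x), probReal_univ, hq]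
    linarith [hL.le_real_seedOpen hσ hj hx]
  have hpiece : ∀ κ ∈ σ.K.powerset.filter (fun κ => σ.N ≤ κ.card),
      μ.real (Bκ κ ∩ ⋂ x ∈ σ.pick κ, Cx x) ≤ q ^ σ.k * μ.real (Bκ κ) := by
    intro κ hκ
    obtain ⟨hκK, hκN⟩ := Finset.mem_filter.1 hκ
    rw [Finset.mem_powerset] at hκK
    have hselK : σ.pick κ ⊆ σ.K := (hσ.pick_sub κ).trans hκK
    have hdisj : (↑(σ.pick κ) : Set V).PairwiseDisjoint σ.seed := hσ.pick_disj κ hκK hκN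
    have hA : DeterminedBy (Bκ κ) (⋃ x ∈ σ.pick κ, (↑(σ.seed x) : Set (Sym2 V)))ᶜ := by
      refine (hBdet κ).mono fun e he hmem => ?_
      simp only [Set.mem_iUnion, exists_prop, Finset.mem_coe] at hmem
      obtain ⟨x, hx, hex⟩ := hmem
      obtain ⟨z, hz, hzX⟩ := hσ.touch x (hselK hx) e hex
      exact ((mk_mem_wireSet_iff.1 (show s(z, Sym2.Mem.other hz) ∈ wireSet (L.region j) by
        rwa [Sym2.other_spec hz])).1).1 (Finset.mem_coe.2 hzX)
    rw [hμ, prodBernoulli_real_inter_biInter_of_determinedBy W (σ.pick κ) σ.seed hdisj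
      (fun x _ => hCdet x) (fun x _ => hCm x) hA (hBm κ), mul_comm]
    refine mul_le_mul_of_nonneg_right ?_ measureReal_nonneg
    calc ∏ x ∈ σ.pick κ, (prodBernoulli W).real (Cx x) ≤ ∏ _x ∈ σ.pick κ, q :=
          Finset.prod_le_prod (fun x _ => measureReal_nonneg) fun x hx => hCle x (hselK hx)
      _ = q ^ σ.k := by rw [Finset.prod_const, hσ.pick_card κ hκK hκN]
  -- sum up
  have hdisjB : (↑(σ.K.powerset.filter (fun κ => σ.N ≤ κ.card)) : Set (Finset V)).PairwiseDisjoint Bκ := by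
    intro κ _ κ' _ hne
    exact Set.disjoint_left.2 fun ω h1 h2 => hne (h1.symm.trans h2)
  calc μ.real ((L.Fail σ.N j)ᶜ \ L.Gev σ j)
      ≤ μ.real (⋃ κ ∈ σ.K.powerset.filter (fun κ => σ.N ≤ κ.card), (Bκ κ ∩ ⋂ x ∈ σ.pick κ, Cx x)) :=
        measureReal_mono hcov (measure_ne_top _ _)
    _ ≤ ∑ κ ∈ σ.K.powerset.filter (fun κ => σ.N ≤ κ.card), μ.real (Bκ κ ∩ ⋂ x ∈ σ.pick κ, Cx x) :=
        measureReal_biUnion_finset_le _ _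
    _ ≤ ∑ κ ∈ σ.K.powerset.filter (fun κ => σ.N ≤ κ.card), q ^ σ.k * μ.real (Bκ κ) := Finset.sum_le_sum hpiece
    _ = q ^ σ.k * μ.real (⋃ κ ∈ σ.K.powerset.filter (fun κ => σ.N ≤ κ.card), Bκ κ) := by
        rw [← Finset.mul_sum, measureReal_biUnion_finset hdisjB (fun κ _ => hBm κ)]
    _ ≤ q ^ σ.k * 1 := mul_le_mul_of_nonneg_left measureReal_le_one (pow_nonneg hq0 _)
    _ = q ^ σ.k := mul_one _

end LHyp

/-! ## §4 The algebra of the events `F_x` -/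

namespace LData

variable {G : SimpleGraph V} [G.LocallyFinite] {L : LData G} {σ : SData V}

/-- `F_x ⊆ oSeed x`. [folklore] -/
theorem Fx_subset_oSeed {j : ℕ} (x : V) : L.Fx σ j x ⊆ L.oSeed σ j x :=
  Set.inter_subset_left

/-- The events `F_x`, `x ∈ K`, are pairwise disjoint. [cite: KozmaNitzan2024, §4 p. 19 ("These events are disjoint")] -/
theorem Fx_disjoint {j : ℕ} {x x' : V} (hne : x ≠ x') (hx' : x' ∈ σ.K) (hx : x ∈ σ.K) :
    Disjoint (L.Fx σ j x) (L.Fx σ j x') := by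
  have hne' : rank σ.K x ≠ rank σ.K x' := rank_ne_of_ne hx hx' hne
  rw [Set.disjoint_left]
  intro ω hω hω'
  rw [mem_Fx_iff] at hω hω'
  rcases lt_or_gt_of_ne hne' with hlt | hlt
  · exact hω'.2 x hx hlt hω.1
  · exact hω.2 x' hx' hlt hω'.1

/-- As a `PairwiseDisjoint` family over `K`. [folklore] -/
theorem Fx_pairwiseDisjoint (j : ℕ) : (↑σ.K : Set V).PairwiseDisjoint (L.Fx σ j) :=
  fun _ hx _ hx' hne => Fx_disjoint hne (Finset.mem_coe.1 hx') (Finset.mem_coe.1 hx)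

/-- `⋃_{x ∈ K} F_x = 𝒢` (first-index decomposition). [cite: KozmaNitzan2024, §4 p. 19 ((20))] -/
theorem biUnion_Fx_eq_Gev (j : ℕ) : ⋃ x ∈ σ.K, L.Fx σ j x = L.Gev σ j := by
  classical
  ext ω
  simp only [Set.mem_iUnion, exists_prop, mem_Gev_iff]
  constructor
  · rintro ⟨x, hx, hF⟩; exact ⟨x, hx, Fx_subset_oSeed x hF⟩
  · rintro ⟨x, hx, hωx⟩
    -- the first candidate (in the enumeration) with an open selected seed
    obtain ⟨x₀, hx₀, hmin⟩ := Finset.exists_min_image (σ.K.filter fun x' => ω ∈ L.oSeed σ j x') (rank σ.K)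
      ⟨x, Finset.mem_filter.2 ⟨hx, hωx⟩⟩
    obtain ⟨hx₀K, hωx₀⟩ := Finset.mem_filter.1 hx₀
    refine ⟨x₀, hx₀K, ?_⟩
    rw [mem_Fx_iff]
    refine ⟨hωx₀, fun x' hx' hlt hωx' => ?_⟩
    exact absurd (hmin x' (Finset.mem_filter.2 ⟨hx', hωx'⟩)) (not_le.2 hlt)

/-- **Locality of `oSeed x` off the seeds**: `oSeed x` only depends on the pairs of the region outside `B⟨j⟩` and on the seed edges of
`x`; so if `S ⊆ B⟨j⟩` and no seed edge of `x` is a pair inside `S`, then `oSeed x` is not affected by the states of the pairs inside `S`.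
[cite: KozmaNitzan2024, §4 p. 21 ("P_{K_ξ}(F_P) = P_G(F_P)")] -/
theorem oSeed_congr {j : ℕ} {S : Finset V} (hSX : S ⊆ L.X j) {x : V}
    (hxS : ∀ e ∈ σ.seed x, e ∉ wireSet (↑S : Set V)) {ω ω' : BondConfig V}
    (h : ∀ e ∉ wireSet (↑S : Set V), e ∈ ω ↔ e ∈ ω') : ω ∈ L.oSeed σ j x ↔ ω' ∈ L.oSeed σ j x := by
  -- pairs of the region are not pairs inside `S`
  have hreg : ∀ e ∈ wireSet (L.region j), e ∈ ω ↔ e ∈ ω' := by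
    intro e he
    refine h e fun heS => ?_
    induction e using Sym2.ind with
    | h a b =>
      have h1 := (mk_mem_wireSet_iff.1 he).1
      have h2 := (mk_mem_wireSet_iff.1 heS).1
      exact h1.1 (Finset.mem_coe.2 (hSX (Finset.mem_coe.1 h2)))
  have hseed : ∀ e ∈ σ.seed x, e ∈ ω ↔ e ∈ ω' := fun e he => h e (hxS e he)
  simp only [oSeed, Set.mem_inter_iff, Set.mem_setOf_eq, sel, Kont_congr hreg]
  exact and_congr_right fun _ => σ.seedOpen_congr hseed

/-- Same for `F_x`. [cite: KozmaNitzan2024, §4 p. 21] -/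
theorem Fx_congr {j : ℕ} {S : Finset V} (hSX : S ⊆ L.X j)
    (hS : ∀ x ∈ σ.K, ∀ e ∈ σ.seed x, e ∉ wireSet (↑S : Set V)) {x : V} (hx : x ∈ σ.K)
    {ω ω' : BondConfig V} (h : ∀ e ∉ wireSet (↑S : Set V), e ∈ ω ↔ e ∈ ω') :
    ω ∈ L.Fx σ j x ↔ ω' ∈ L.Fx σ j x := by
  rw [mem_Fx_iff, mem_Fx_iff, oSeed_congr hSX (hS x hx) h]
  refine and_congr_right fun _ => forall₂_congr fun x' hx' => forall_congr' fun _ => ?_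
  rw [oSeed_congr hSX (hS x' hx') h]

/-- `F_x` is determined by the complement of the pairs inside `S`. [cite: KozmaNitzan2024, §4 p. 21] -/
theorem determinedBy_Fx {j : ℕ} {S : Finset V} (hSX : S ⊆ L.X j)
    (hS : ∀ x ∈ σ.K, ∀ e ∈ σ.seed x, e ∉ wireSet (↑S : Set V)) {x : V} (hx : x ∈ σ.K) :
    DeterminedBy (L.Fx σ j x) (wireSet (↑S : Set V))ᶜ := by
  rw [determinedBy_iff]
  intro ω ω' hω
  refine Fx_congr hSX hS hx fun e he => ?_
  have := Set.ext_iff.1 hω e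
  simp only [Set.mem_inter_iff, Set.mem_compl_iff] at this
  exact ⟨fun h' => (this.1 ⟨h', he⟩).1, fun h' => (this.2 ⟨h', he⟩).1⟩

/-- `oSeed x` is determined by the finite set of pairs of `Sfin` together with the seed edges of `x`. [folklore] -/
theorem determinedBy_oSeed (j : ℕ) (x : V) :
    DeterminedBy (L.oSeed σ j x) (↑(pairsF L.Sfin ∪ σ.seed x) : Set (Sym2 V)) := by
  rw [determinedBy_iff]
  intro ω ω' hω
  have hag : ∀ e ∈ pairsF L.Sfin ∪ σ.seed x, e ∈ ω ↔ e ∈ ω' := fun e he => by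
    have := Set.ext_iff.1 hω e
    simp only [Set.mem_inter_iff, Finset.mem_coe] at this
    exact ⟨fun h' => (this.1 ⟨h', he⟩).1, fun h' => (this.2 ⟨h', he⟩).1⟩
  have hreg : ∀ e ∈ wireSet (L.region j), e ∈ ω ↔ e ∈ ω' := fun e he =>
    hag e (Finset.mem_union_left _ (L.mem_pairsF_of_mem_wireSet_region he))
  simp only [oSeed, Set.mem_inter_iff, Set.mem_setOf_eq, sel, Kont_congr hreg]
  exact and_congr_right fun _ => σ.seedOpen_congr fun e he => hag e (Finset.mem_union_right _ he)

/-- `oSeed x` is measurable. [folklore] -/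
theorem measurableSet_oSeed (j : ℕ) (x : V) : MeasurableSet (L.oSeed σ j x) :=
  (determinedBy_oSeed (L := L) (σ := σ) j x).measurableSet_of_finset

/-- `F_x` is measurable. [folklore] -/
theorem measurableSet_Fx (j : ℕ) (x : V) : MeasurableSet (L.Fx σ j x) := by
  unfold Fx
  refine (measurableSet_oSeed j x).inter ?_
  exact Finset.measurableSet_biInter _ fun x' _ => (measurableSet_oSeed j x').compl

/-- `𝒢` is measurable. [folklore] -/
theorem measurableSet_Gev (j : ℕ) : MeasurableSet (L.Gev σ j) :=
  Finset.measurableSet_biUnion _ fun x _ => measurableSet_oSeed j x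

/-- **On `oSeed x`, `o` is joined to every vertex of the face behind `x`** (through `x`, which is a contact vertex, and the open seed).
[cite: KozmaNitzan2024, §4 p. 21 ("hence o connects to A_ξ")] -/
theorem openConn_of_mem_oSeed {j : ℕ} (hσ : SHyp L j σ) {x : V} {ω : BondConfig V}
    (hω : ω ∈ L.oSeed σ j x) {u : V} (hu : u ∈ σ.face x) : ω ∈ openConn L.o u := by
  obtain ⟨hsel, hseed⟩ := hω
  have hxK : x ∈ L.Kont j ω := sel_subset_Kont hσ.pick_sub ω hsel
  obtain ⟨-, hox⟩ := mem_Kont_iff.1 hxK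
  rw [DCT16.mem_openConnIn_iff_pathIn] at hox
  have hxu : ω ∈ openConn x u := hσ.conn x (hσ.Kont_sub ω hxK) ω hseed u hu
  exact (reachable_of_pathIn hox).trans hxu

end LData

end KNLevels

end Transplant

end Summit.CriticalPhenomena.PercolationContinuityZ3.Theorems

end
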